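import Literature.LinearAlgebra.Matrix.HermitianAdjointCartanAlgebra
import Mathlib.RingTheory.Artinian.Module
import Mathlib.RingTheory.Adjoin.PowerBasis
import HarnessLib

/-!
# The simple factors of the algebra `L[γ]` of a regular semisimple matrix: dimension `N`, `∑ deg = N`, and roots of `p_γ` in `L` ↔ the
# factors of degree one (Horn–Johnson 2013 §3.3; Rogawski 1990 §3.4–§3.6 pp. 27–31 for the use)

Topic `LinearAlgebra/Matrix` (sequel of ★ `HermitianAdjointCartanAlgebra`: `L[γ]` is commutative and, for `p_γ` separable, reduced with `q_γ = p_γ`);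
namespace `Literature.LinearAlgebra.Matrix`; THEOREMS ONLY (no definition, no instance, no notation, no named fact, no `sorry`).  Cell
`pub/hodgecm-mathlib`, ENGINE T1 (crux H413), the field-free half of (KS-2b) `Rogawski1990/EndoscopicKappaBijection` (the degree-one τ-stable factors
of the Cartan algebra `L[γ₀]` ↔ the endoscopic classes over `𝒪_st(γ₀)`).

Throughout `γ ∈ M_N(L)` over a field `L`, `B := L[γ] = Algebra.adjoin L {γ}`, `γ′ := ⟨γ, _⟩ ∈ B` («`matrixGen`» in the names), `deg 𝔪 := dim_L (B ∕ 𝔪)`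
for a maximal ideal `𝔪` of the (commutative, Mathlib `Algebra.isMulCommutative_adjoin_singleton`) algebra `B`.
* §1 `adjoin_matrixGen_eq_top` (`B = L[γ′]`), `exists_eq_aeval_matrixGen` (every element is `p(γ)`), `aeval_matrixGen_charpoly` (Cayley–Hamilton in
  `B`), `minpoly_matrixGen` (`q_{γ′} = q_γ`), **`finrank_adjoin_singleton_eq_of_charpoly_separable : dim_L B = N`** (Mathlib `PowerBasis.ofAdjoinEqTop`
  + ★ `minpoly_eq_charpoly_of_charpoly_separable`), `one_le_finrank_adjoin_singleton_quotient : 1 ≤ deg 𝔪`,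
  **`sum_finrank_adjoin_singleton_quotient_eq : ∑_𝔪 deg 𝔪 = N`** (`B` reduced ★ `isReduced_adjoin_singleton` and Artinian ⇒ `B ≅ ∏_𝔪 B∕𝔪`, Mathlib
  `IsArtinianRing.equivPi`).
* §2 roots ↔ degree-one factors: `aeval_matrixGen_sub_algebraMap_eval_mem` (`p(γ) − p(u) ∈ 𝔪 ∋ γ − u`), `algebraMap_mem_maximalSpectrum_adjoin_iff`,
  `aeval_matrixGen_mem_iff` (`p(γ) ∈ 𝔪 ↔ p(u) = 0`), **`isRoot_charpoly_of_matrixGen_sub_algebraMap_mem`** (`γ − u ∈ 𝔪 ⇒ p_γ(u) = 0`),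
  `eq_of_matrixGen_sub_algebraMap_mem` ∕ **`maximalSpectrum_eq_of_matrixGen_sub_algebraMap_mem`** (the factor `𝔪_u ∋ γ − u` is unique and determines
  `u`), `coe_algebraMap_adjoin_singleton_eq_scalar`, **`exists_maximalSpectrum_matrixGen_sub_algebraMap_mem`** (a root `u` HAS a factor `𝔪_u`:
  `det(u − γ) = p_γ(u) = 0` makes `γ − u` a non-unit), `surjective_algebraMap_adjoin_singleton_quotient` (`B∕𝔪_u = L`),
  **`finrank_quotient_eq_one_of_matrixGen_sub_algebraMap_mem : deg 𝔪_u = 1`**, **`exists_matrixGen_sub_algebraMap_mem_of_finrank_eq_one`**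
  (a degree-one factor is some `𝔪_u`).

## References
* [HornJohnson2013] R. A. Horn, C. R. Johnson, *Matrix Analysis*, 2nd ed. (2013), §3.3 (Thm. 3.3.15 p. 257: nonderogatory matrices, `L[A] ≅ L[X]∕(p_A)`).
* [Rogawski1990] J. D. Rogawski, *Automorphic Representations of Unitary Groups in Three Variables*, Ann. of Math. Stud. 123 (1990), §3.4 p. 27, §3.6 p. 31.
-/

set_option autoImplicit false

noncomputable section

open Polynomial
open scoped Matrix BigOperators

namespace Literature.LinearAlgebra.Matrix

/-! ## §1 The Cartan algebra `L[γ]` as an `L`-algebra: generator, Cayley–Hamilton, dimension `N`, the simple factors -/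

section Structure

variable {L : Type} [Field L] {N : ℕ} (γ : Matrix (Fin N) (Fin N) L)

/-- `L[γ]` is generated, as an `L`-algebra, by (the image of) `γ`. [cite: HornJohnson2013, §3.3 Thm. 3.3.15 p. 257] -/
theorem adjoin_matrixGen_eq_top :
    Algebra.adjoin L {(⟨γ, Algebra.self_mem_adjoin_singleton L γ⟩ : ↥(Algebra.adjoin L ({γ} : Set (Matrix (Fin N) (Fin N) L))))} = ⊤ := by
  have h := Algebra.adjoin_adjoin_coe_preimage (R := L) (s := ({γ} : Set (Matrix (Fin N) (Fin N) L)))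
  have hpre : (((↑) : ↥(Algebra.adjoin L ({γ} : Set (Matrix (Fin N) (Fin N) L))) → Matrix (Fin N) (Fin N) L) ⁻¹' {γ}) =
      {(⟨γ, Algebra.self_mem_adjoin_singleton L γ⟩ : ↥(Algebra.adjoin L ({γ} : Set (Matrix (Fin N) (Fin N) L))))} := by
    ext b
    simp only [Set.mem_preimage, Set.mem_singleton_iff, Subtype.ext_iff]
  rw [hpre] at h
  exact h

/-- Every element of `L[γ]` is a polynomial in `γ`. [cite: HornJohnson2013, §3.3 Thm. 3.3.15 p. 257] -/
theorem exists_eq_aeval_matrixGen (b : ↥(Algebra.adjoin L ({γ} : Set (Matrix (Fin N) (Fin N) L)))) :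
    ∃ p : L[X], b = aeval (⟨γ, Algebra.self_mem_adjoin_singleton L γ⟩ : ↥(Algebra.adjoin L ({γ} : Set (Matrix (Fin N) (Fin N) L)))) p := by
  have hb : b ∈ Algebra.adjoin L {(⟨γ, Algebra.self_mem_adjoin_singleton L γ⟩ : ↥(Algebra.adjoin L ({γ} : Set (Matrix (Fin N) (Fin N) L))))} := by
    rw [adjoin_matrixGen_eq_top]; exact Algebra.mem_top
  have hb' : b ∈ (aeval (R := L) (⟨γ, Algebra.self_mem_adjoin_singleton L γ⟩ : ↥(Algebra.adjoin L ({γ} : Set (Matrix (Fin N) (Fin N) L))))).range := by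
    rw [← Algebra.adjoin_singleton_eq_range_aeval]; exact hb
  obtain ⟨p, hp⟩ := hb'
  exact ⟨p, hp.symm⟩

/-- Cayley–Hamilton inside `L[γ]`: `p_γ(γ) = 0`. [cite: HornJohnson2013, §3.3 Thm. 3.3.15 p. 257] -/
theorem aeval_matrixGen_charpoly :
    aeval (⟨γ, Algebra.self_mem_adjoin_singleton L γ⟩ : ↥(Algebra.adjoin L ({γ} : Set (Matrix (Fin N) (Fin N) L)))) γ.charpoly = 0 := by
  apply Subtype.ext
  rw [aeval_subalgebra_coe]
  exact Matrix.aeval_self_charpoly γ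

/-- The minimal polynomial of `γ ∈ L[γ]` is that of the matrix `γ`. [cite: HornJohnson2013, §3.3 Thm. 3.3.15 p. 257] -/
theorem minpoly_matrixGen :
    minpoly L (⟨γ, Algebra.self_mem_adjoin_singleton L γ⟩ : ↥(Algebra.adjoin L ({γ} : Set (Matrix (Fin N) (Fin N) L)))) = minpoly L γ := by
  rw [← minpoly.algHom_eq (Algebra.adjoin L ({γ} : Set (Matrix (Fin N) (Fin N) L))).val Subtype.val_injective]
  rfl

/-- **`dim_L L[γ] = N`** for `γ` regular semisimple (`p_γ` separable, so `q_γ = p_γ` — ★ `minpoly_eq_charpoly_of_charpoly_separable` — and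
`1, γ, …, γ^{N−1}` is a basis). [cite: Rogawski1990, §3.4 p. 27] -/
theorem finrank_adjoin_singleton_eq_of_charpoly_separable (hreg : γ.charpoly.Separable) :
    Module.finrank L ↥(Algebra.adjoin L ({γ} : Set (Matrix (Fin N) (Fin N) L))) = N := by
  have hint : IsIntegral L (⟨γ, Algebra.self_mem_adjoin_singleton L γ⟩ : ↥(Algebra.adjoin L ({γ} : Set (Matrix (Fin N) (Fin N) L)))) :=
    .of_finite L _
  rw [(PowerBasis.ofAdjoinEqTop hint (adjoin_matrixGen_eq_top γ)).finrank, PowerBasis.ofAdjoinEqTop_dim, minpoly_matrixGen,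
    minpoly_eq_charpoly_of_charpoly_separable γ hreg, Matrix.charpoly_natDegree_eq_dim, Fintype.card_fin]

/-- Each simple factor `L[γ] ∕ 𝔪` has POSITIVE degree over `L`. [cite: HornJohnson2013, §3.3 Thm. 3.3.15 p. 257] -/
theorem one_le_finrank_adjoin_singleton_quotient (𝔪 : MaximalSpectrum ↥(Algebra.adjoin L ({γ} : Set (Matrix (Fin N) (Fin N) L)))) :
    1 ≤ Module.finrank L (↥(Algebra.adjoin L ({γ} : Set (Matrix (Fin N) (Fin N) L))) ⧸ 𝔪.asIdeal) := by
  haveI : Nontrivial (↥(Algebra.adjoin L ({γ} : Set (Matrix (Fin N) (Fin N) L))) ⧸ 𝔪.asIdeal) :=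
    Ideal.Quotient.nontrivial_iff.2 𝔪.isMaximal.ne_top
  exact Module.finrank_pos

/-- **`∑_𝔪 dim_L (L[γ] ∕ 𝔪) = N`** over ALL maximal ideals of the Cartan algebra of a regular semisimple `γ`: `L[γ]` is reduced (★
`isReduced_adjoin_singleton`) and Artinian, hence the product of its simple factors (Mathlib `IsArtinianRing.equivPi`), and `dim_L L[γ] = N`.
[cite: Rogawski1990, §3.4 p. 27] -/
theorem sum_finrank_adjoin_singleton_quotient_eq [Fintype (MaximalSpectrum ↥(Algebra.adjoin L ({γ} : Set (Matrix (Fin N) (Fin N) L))))] (hreg : γ.charpoly.Separable) :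
    ∑ 𝔪 : MaximalSpectrum ↥(Algebra.adjoin L ({γ} : Set (Matrix (Fin N) (Fin N) L))),
      Module.finrank L (↥(Algebra.adjoin L ({γ} : Set (Matrix (Fin N) (Fin N) L))) ⧸ 𝔪.asIdeal) = N := by
  haveI : IsArtinianRing ↥(Algebra.adjoin L ({γ} : Set (Matrix (Fin N) (Fin N) L))) := IsArtinianRing.of_finite L _
  haveI : IsReduced ↥(Algebra.adjoin L ({γ} : Set (Matrix (Fin N) (Fin N) L))) := isReduced_adjoin_singleton γ hreg
  haveI : ∀ 𝔪 : MaximalSpectrum ↥(Algebra.adjoin L ({γ} : Set (Matrix (Fin N) (Fin N) L))),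
      Module.Free L (↥(Algebra.adjoin L ({γ} : Set (Matrix (Fin N) (Fin N) L))) ⧸ 𝔪.asIdeal) := fun _ => Module.Free.of_divisionRing L _
  haveI : ∀ 𝔪 : MaximalSpectrum ↥(Algebra.adjoin L ({γ} : Set (Matrix (Fin N) (Fin N) L))),
      Module.Finite L (↥(Algebra.adjoin L ({γ} : Set (Matrix (Fin N) (Fin N) L))) ⧸ 𝔪.asIdeal) := fun _ => inferInstance
  let e := ((IsArtinianRing.equivPi ↥(Algebra.adjoin L ({γ} : Set (Matrix (Fin N) (Fin N) L)))).toLinearEquiv).restrictScalars L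
  rw [← Module.finrank_pi_fintype L, ← e.finrank_eq, finrank_adjoin_singleton_eq_of_charpoly_separable γ hreg]

end Structure

/-! ## §2 Roots of `p_γ` in `L` ↔ the degree-one simple factors: `u ↦ 𝔪_u ∋ γ − u`, `dim_L (L[γ] ∕ 𝔪_u) = 1` -/

section Roots

variable {L : Type} [Field L] {N : ℕ} (γ : Matrix (Fin N) (Fin N) L)

/-- `p(γ) − p(u) ∈ 𝔪` whenever `γ − u ∈ 𝔪` (`X − u ∣ p − p(u)`). [cite: HornJohnson2013, §3.3 p. 257] [cite: Rogawski1990, §3.6 p. 31] -/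
theorem aeval_matrixGen_sub_algebraMap_eval_mem (𝔪 : Ideal ↥(Algebra.adjoin L ({γ} : Set (Matrix (Fin N) (Fin N) L)))) {u : L}
    (h : (⟨γ, Algebra.self_mem_adjoin_singleton L γ⟩ : ↥(Algebra.adjoin L ({γ} : Set (Matrix (Fin N) (Fin N) L)))) -
      algebraMap L ↥(Algebra.adjoin L ({γ} : Set (Matrix (Fin N) (Fin N) L))) u ∈ 𝔪) (p : L[X]) :
    aeval (⟨γ, Algebra.self_mem_adjoin_singleton L γ⟩ : ↥(Algebra.adjoin L ({γ} : Set (Matrix (Fin N) (Fin N) L)))) p -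
      algebraMap L ↥(Algebra.adjoin L ({γ} : Set (Matrix (Fin N) (Fin N) L))) (p.eval u) ∈ 𝔪 := by
  have hdvd := map_dvd (aeval (R := L) (⟨γ, Algebra.self_mem_adjoin_singleton L γ⟩ : ↥(Algebra.adjoin L ({γ} : Set (Matrix (Fin N) (Fin N) L)))))
    (Polynomial.X_sub_C_dvd_sub_C_eval (a := u) (p := p))
  rw [map_sub, map_sub, aeval_X, aeval_C, aeval_C] at hdvd
  obtain ⟨c, hc⟩ := hdvd
  rw [hc]
  exact Ideal.mul_mem_right _ _ h

/-- A scalar lies in a maximal ideal of `L[γ]` iff it is `0`. [cite: HornJohnson2013, §3.3 p. 257] [cite: Rogawski1990, §3.6 p. 31] -/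
theorem algebraMap_mem_maximalSpectrum_adjoin_iff (𝔪 : MaximalSpectrum ↥(Algebra.adjoin L ({γ} : Set (Matrix (Fin N) (Fin N) L)))) (c : L) :
    algebraMap L ↥(Algebra.adjoin L ({γ} : Set (Matrix (Fin N) (Fin N) L))) c ∈ 𝔪.asIdeal ↔ c = 0 := by
  refine ⟨fun h => ?_, fun h => by rw [h, map_zero]; exact 𝔪.asIdeal.zero_mem⟩
  by_contra hc
  exact 𝔪.isMaximal.ne_top (Ideal.eq_top_of_isUnit_mem _ h ((IsUnit.mk0 c hc).map _))

/-- **`p(γ) ∈ 𝔪_u ↔ p(u) = 0`** for the maximal ideal `𝔪_u ∋ γ − u`. [cite: HornJohnson2013, §3.3 p. 257] [cite: Rogawski1990, §3.6 p. 31] -/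
theorem aeval_matrixGen_mem_iff (𝔪 : MaximalSpectrum ↥(Algebra.adjoin L ({γ} : Set (Matrix (Fin N) (Fin N) L)))) {u : L}
    (h : (⟨γ, Algebra.self_mem_adjoin_singleton L γ⟩ : ↥(Algebra.adjoin L ({γ} : Set (Matrix (Fin N) (Fin N) L)))) -
      algebraMap L ↥(Algebra.adjoin L ({γ} : Set (Matrix (Fin N) (Fin N) L))) u ∈ 𝔪.asIdeal) (p : L[X]) :
    aeval (⟨γ, Algebra.self_mem_adjoin_singleton L γ⟩ : ↥(Algebra.adjoin L ({γ} : Set (Matrix (Fin N) (Fin N) L)))) p ∈ 𝔪.asIdeal ↔ p.eval u = 0 := by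
  have hsplit : aeval (⟨γ, Algebra.self_mem_adjoin_singleton L γ⟩ : ↥(Algebra.adjoin L ({γ} : Set (Matrix (Fin N) (Fin N) L)))) p =
      (aeval (⟨γ, Algebra.self_mem_adjoin_singleton L γ⟩ : ↥(Algebra.adjoin L ({γ} : Set (Matrix (Fin N) (Fin N) L)))) p -
        algebraMap L ↥(Algebra.adjoin L ({γ} : Set (Matrix (Fin N) (Fin N) L))) (p.eval u)) +
        algebraMap L ↥(Algebra.adjoin L ({γ} : Set (Matrix (Fin N) (Fin N) L))) (p.eval u) := by abel
  rw [hsplit, Submodule.add_mem_iff_right _ (aeval_matrixGen_sub_algebraMap_eval_mem γ 𝔪.asIdeal h p), algebraMap_mem_maximalSpectrum_adjoin_iff]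

/-- **`γ − u ∈ 𝔪` for a maximal `𝔪` forces `p_γ(u) = 0`** (Cayley–Hamilton). [cite: Rogawski1990, §3.4 p. 27] -/
theorem isRoot_charpoly_of_matrixGen_sub_algebraMap_mem (𝔪 : MaximalSpectrum ↥(Algebra.adjoin L ({γ} : Set (Matrix (Fin N) (Fin N) L)))) {u : L}
    (h : (⟨γ, Algebra.self_mem_adjoin_singleton L γ⟩ : ↥(Algebra.adjoin L ({γ} : Set (Matrix (Fin N) (Fin N) L)))) -
      algebraMap L ↥(Algebra.adjoin L ({γ} : Set (Matrix (Fin N) (Fin N) L))) u ∈ 𝔪.asIdeal) :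
    γ.charpoly.IsRoot u := by
  rw [IsRoot.def, ← aeval_matrixGen_mem_iff γ 𝔪 h, aeval_matrixGen_charpoly]
  exact 𝔪.asIdeal.zero_mem

/-- A maximal ideal contains `γ − u` for AT MOST ONE scalar `u`. [cite: HornJohnson2013, §3.3 p. 257] [cite: Rogawski1990, §3.6 p. 31] -/
theorem eq_of_matrixGen_sub_algebraMap_mem (𝔪 : MaximalSpectrum ↥(Algebra.adjoin L ({γ} : Set (Matrix (Fin N) (Fin N) L)))) {u v : L}
    (hu : (⟨γ, Algebra.self_mem_adjoin_singleton L γ⟩ : ↥(Algebra.adjoin L ({γ} : Set (Matrix (Fin N) (Fin N) L)))) -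
      algebraMap L ↥(Algebra.adjoin L ({γ} : Set (Matrix (Fin N) (Fin N) L))) u ∈ 𝔪.asIdeal)
    (hv : (⟨γ, Algebra.self_mem_adjoin_singleton L γ⟩ : ↥(Algebra.adjoin L ({γ} : Set (Matrix (Fin N) (Fin N) L)))) -
      algebraMap L ↥(Algebra.adjoin L ({γ} : Set (Matrix (Fin N) (Fin N) L))) v ∈ 𝔪.asIdeal) : u = v := by
  have hmem := 𝔪.asIdeal.sub_mem hv hu
  rw [sub_sub_sub_cancel_left, ← map_sub, algebraMap_mem_maximalSpectrum_adjoin_iff, sub_eq_zero] at hmem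
  exact hmem

/-- **Uniqueness of `𝔪_u`**: two maximal ideals containing `γ − u` coincide (both are `{p(γ) ∣ p(u) = 0}`). [cite: HornJohnson2013, §3.3 p. 257] [cite: Rogawski1990, §3.6 p. 31] -/
theorem maximalSpectrum_eq_of_matrixGen_sub_algebraMap_mem {𝔪 𝔫 : MaximalSpectrum ↥(Algebra.adjoin L ({γ} : Set (Matrix (Fin N) (Fin N) L)))} {u : L}
    (h𝔪 : (⟨γ, Algebra.self_mem_adjoin_singleton L γ⟩ : ↥(Algebra.adjoin L ({γ} : Set (Matrix (Fin N) (Fin N) L)))) -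
      algebraMap L ↥(Algebra.adjoin L ({γ} : Set (Matrix (Fin N) (Fin N) L))) u ∈ 𝔪.asIdeal)
    (h𝔫 : (⟨γ, Algebra.self_mem_adjoin_singleton L γ⟩ : ↥(Algebra.adjoin L ({γ} : Set (Matrix (Fin N) (Fin N) L)))) -
      algebraMap L ↥(Algebra.adjoin L ({γ} : Set (Matrix (Fin N) (Fin N) L))) u ∈ 𝔫.asIdeal) : 𝔪 = 𝔫 := by
  apply MaximalSpectrum.ext
  ext b
  obtain ⟨p, rfl⟩ := exists_eq_aeval_matrixGen γ b
  rw [aeval_matrixGen_mem_iff γ 𝔪 h𝔪, aeval_matrixGen_mem_iff γ 𝔫 h𝔫]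

/-- The scalar `u ∈ L ⊆ L[γ] ⊆ M_N(L)` is the scalar matrix `u · 1`. [cite: HornJohnson2013, §3.3 p. 257] [cite: Rogawski1990, §3.6 p. 31] -/
theorem coe_algebraMap_adjoin_singleton_eq_scalar (u : L) :
    ((algebraMap L ↥(Algebra.adjoin L ({γ} : Set (Matrix (Fin N) (Fin N) L))) u : ↥(Algebra.adjoin L ({γ} : Set (Matrix (Fin N) (Fin N) L)))) :
      Matrix (Fin N) (Fin N) L) = Matrix.scalar (Fin N) u := by
  rw [Subalgebra.coe_algebraMap, Algebra.algebraMap_eq_smul_one, Matrix.scalar_apply, Matrix.smul_one_eq_diagonal]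

/-- **Existence of `𝔪_u`**: a root `u ∈ L` of `p_γ` makes `γ − u` a NON-UNIT of `L[γ]` (`det (u − γ) = p_γ(u) = 0`), so some maximal ideal
contains it. [cite: Rogawski1990, §3.4 p. 27] -/
theorem exists_maximalSpectrum_matrixGen_sub_algebraMap_mem {u : L} (hu : γ.charpoly.IsRoot u) :
    ∃ 𝔪 : MaximalSpectrum ↥(Algebra.adjoin L ({γ} : Set (Matrix (Fin N) (Fin N) L))),
      (⟨γ, Algebra.self_mem_adjoin_singleton L γ⟩ : ↥(Algebra.adjoin L ({γ} : Set (Matrix (Fin N) (Fin N) L)))) -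
        algebraMap L ↥(Algebra.adjoin L ({γ} : Set (Matrix (Fin N) (Fin N) L))) u ∈ 𝔪.asIdeal := by
  have hnu : ¬ IsUnit ((⟨γ, Algebra.self_mem_adjoin_singleton L γ⟩ : ↥(Algebra.adjoin L ({γ} : Set (Matrix (Fin N) (Fin N) L)))) -
      algebraMap L ↥(Algebra.adjoin L ({γ} : Set (Matrix (Fin N) (Fin N) L))) u) := by
    intro hunit
    have hM : IsUnit (γ - Matrix.scalar (Fin N) u) := by
      have h := hunit.map (Algebra.adjoin L ({γ} : Set (Matrix (Fin N) (Fin N) L))).val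
      rw [map_sub] at h
      convert h using 1
      rw [← coe_algebraMap_adjoin_singleton_eq_scalar γ u]
      rfl
    have hdet : (Matrix.scalar (Fin N) u - γ).det = 0 := by rw [← Matrix.eval_charpoly]; exact hu
    rw [← neg_sub, IsUnit.neg_iff, Matrix.isUnit_iff_isUnit_det, hdet] at hM
    exact not_isUnit_zero hM
  obtain ⟨M, hM, hle⟩ := Ideal.exists_le_maximal _ (mt Ideal.span_singleton_eq_top.1 hnu)
  exact ⟨⟨M, hM⟩, hle (Ideal.mem_span_singleton_self _)⟩

/-- Modulo an ideal containing `γ − u` every element of `L[γ]` is a SCALAR: `p(γ) ≡ p(u)`. [cite: HornJohnson2013, §3.3 p. 257] [cite: Rogawski1990, §3.6 p. 31] -/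
theorem surjective_algebraMap_adjoin_singleton_quotient (𝔪 : Ideal ↥(Algebra.adjoin L ({γ} : Set (Matrix (Fin N) (Fin N) L)))) {u : L}
    (h : (⟨γ, Algebra.self_mem_adjoin_singleton L γ⟩ : ↥(Algebra.adjoin L ({γ} : Set (Matrix (Fin N) (Fin N) L)))) -
      algebraMap L ↥(Algebra.adjoin L ({γ} : Set (Matrix (Fin N) (Fin N) L))) u ∈ 𝔪) :
    Function.Surjective (algebraMap L (↥(Algebra.adjoin L ({γ} : Set (Matrix (Fin N) (Fin N) L))) ⧸ 𝔪)) := by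
  intro y
  obtain ⟨b, rfl⟩ := Ideal.Quotient.mk_surjective y
  obtain ⟨p, rfl⟩ := exists_eq_aeval_matrixGen γ b
  refine ⟨p.eval u, ?_⟩
  rw [← Ideal.Quotient.mk_algebraMap]
  exact (Ideal.Quotient.eq.2 (aeval_matrixGen_sub_algebraMap_eval_mem γ 𝔪 h p)).symm

/-- **`dim_L (L[γ] ∕ 𝔪_u) = 1`**: the factor through which `γ ↦ u`. [cite: Rogawski1990, §3.6 p. 31] -/
theorem finrank_quotient_eq_one_of_matrixGen_sub_algebraMap_mem (𝔪 : MaximalSpectrum ↥(Algebra.adjoin L ({γ} : Set (Matrix (Fin N) (Fin N) L)))) {u : L}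
    (h : (⟨γ, Algebra.self_mem_adjoin_singleton L γ⟩ : ↥(Algebra.adjoin L ({γ} : Set (Matrix (Fin N) (Fin N) L)))) -
      algebraMap L ↥(Algebra.adjoin L ({γ} : Set (Matrix (Fin N) (Fin N) L))) u ∈ 𝔪.asIdeal) :
    Module.finrank L (↥(Algebra.adjoin L ({γ} : Set (Matrix (Fin N) (Fin N) L))) ⧸ 𝔪.asIdeal) = 1 := by
  haveI : Nontrivial (↥(Algebra.adjoin L ({γ} : Set (Matrix (Fin N) (Fin N) L))) ⧸ 𝔪.asIdeal) :=
    Ideal.Quotient.nontrivial_iff.2 𝔪.isMaximal.ne_top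
  have hbij : Function.Bijective (Algebra.linearMap L (↥(Algebra.adjoin L ({γ} : Set (Matrix (Fin N) (Fin N) L))) ⧸ 𝔪.asIdeal)) :=
    ⟨(algebraMap L (↥(Algebra.adjoin L ({γ} : Set (Matrix (Fin N) (Fin N) L))) ⧸ 𝔪.asIdeal)).injective, surjective_algebraMap_adjoin_singleton_quotient γ 𝔪.asIdeal h⟩
  rw [← (LinearEquiv.ofBijective _ hbij).finrank_eq, Module.finrank_self]

/-- **A degree-one factor comes from a root**: if `dim_L (L[γ] ∕ 𝔪) = 1` then `γ ≡ u (mod 𝔪)` for a (unique) scalar `u`, a root of `p_γ`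
(`isRoot_charpoly_of_matrixGen_sub_algebraMap_mem`). [cite: Rogawski1990, §3.6 p. 31] -/
theorem exists_matrixGen_sub_algebraMap_mem_of_finrank_eq_one (𝔪 : MaximalSpectrum ↥(Algebra.adjoin L ({γ} : Set (Matrix (Fin N) (Fin N) L))))
    (h1 : Module.finrank L (↥(Algebra.adjoin L ({γ} : Set (Matrix (Fin N) (Fin N) L))) ⧸ 𝔪.asIdeal) = 1) :
    ∃ u : L, (⟨γ, Algebra.self_mem_adjoin_singleton L γ⟩ : ↥(Algebra.adjoin L ({γ} : Set (Matrix (Fin N) (Fin N) L)))) -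
      algebraMap L ↥(Algebra.adjoin L ({γ} : Set (Matrix (Fin N) (Fin N) L))) u ∈ 𝔪.asIdeal := by
  have h10 : Ideal.Quotient.mk 𝔪.asIdeal (1 : ↥(Algebra.adjoin L ({γ} : Set (Matrix (Fin N) (Fin N) L)))) ≠ 0 := fun h =>
    𝔪.isMaximal.ne_top ((Ideal.eq_top_iff_one _).2 (Ideal.Quotient.eq_zero_iff_mem.1 h))
  obtain ⟨u, hu⟩ := (finrank_eq_one_iff_of_nonzero' _ h10).1 h1 (Ideal.Quotient.mk 𝔪.asIdeal ⟨γ, Algebra.self_mem_adjoin_singleton L γ⟩)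
  refine ⟨u, Ideal.Quotient.eq.1 ?_⟩
  rw [← hu, Ideal.Quotient.mk_algebraMap, Algebra.algebraMap_eq_smul_one, map_one]

end Roots

end Literature.LinearAlgebra.Matrix

end
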